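import Summits.MatrixMultiplication.MatrixMultiplication.Theorems.ObstructionDescentPolarLinear
import Summits.MatrixMultiplication.MatrixMultiplication.Theorems.ObstructionDescentPairCasimir
import Summits.MatrixMultiplication.MatrixMultiplication.Theses.ObstructionDescent

/- `set_option linter.dupNamespace false` as in the sibling kernel files (namespace `…Theorems.<FileStem>`). -/
set_option linter.dupNamespace false

/-!
# `GapOneEquationsVanish` holds: `I_d(σ_{d−1}((ℂ^N)^{⊗3})) = 0` for `d ≥ 3N − 2` (decomp-mm · lens 3 · gen 23, K2c)

Context: route `route-MatrixMultiplication-ObstructionDescent` (`ω(ℂ) = 2`), attacked leaf `E = NoPolyDegreeObstruction`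
(item 30889), DEGREE axis.  This file DECIDES the aside `GapOneEquationsVanish` (item 27778, NODE-g23 Theorem B):
for `N ≥ 2` and `d ≥ 3N − 2`, a homogeneous polynomial of degree `d` on `ℂ^N ⊗ ℂ^N ⊗ ℂ^N` vanishing on all tensors of
rank `< d` is zero.  Assembly of the polarisation bridge (`ObstructionDescentPolarForm`, `ObstructionDescentPolarLinear`)
with the Casimir kernels (`ObstructionDescentCasimirCount`, `ObstructionDescentPairCasimir`):

1. `cube_identity`: for a form `β` additive in both arguments and vanishing on the diagonal of triads, the sum over
   the eight complementary corner pairs of a `2×2×2` block vanishes (three nested polarisations `b(x,y)+b(y,x) =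
   b(x+y,x+y) − b(x,x) − b(y,y)`, written as one 27-term linear combination);
2. `G3_pair`: with `β(T, T') = polarForm f (… T in slot i … T' in slot j …)` (bi-additive by K2b, diagonal-vanishing
   by DOUBLING VANISHING of K2a) this is the eight-term relation for the coefficient tensor `G3 f`, and
   `pairExchange_of_polar` (diagonal `S_d`-symmetry, `G3_perm`) turns it into the pair-exchange relation;
3. `pairExchange_eq_zero` (Casimir count, `d ≥ 3N − 2`) gives `G3 f = 0`, and RECONSTRUCTION (`eq_zero_of_G3_eq_zero`)
   gives `f = 0`: `gapOneEquationsVanish_holds`.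
[cite: LandsbergManivel2004, Lemma 3.1, Cor. 3.4; Raicu2012, Prop. 3.4; LandsbergGCT2017, Prop. 8.3.4.1]

STATUS: this file's `gapOneEquationsVanish_holds` is the deciding theorem of route item
`stmt-MatrixMultiplication-27778` (`GapOneEquationsVanish`, aside of `ObstructionDescent`): PROVED.
-/

namespace Summit.MatrixMultiplication.MatrixMultiplication.Theorems.ObstructionDescentGapOne

open MvPolynomial Finset
open ObstructionDescentPolarForm ObstructionDescentPolarLinear ObstructionDescentCasimirCount
  ObstructionDescentPairCasimir
open Literature.Computability.AlgebraicComplexity (tensorRank)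

variable {N d : ℕ}

/-! ## Triads as functions on `Pt N` -/

/-- The triad `u ⊗ v ⊗ w` as a function on coordinates. [this cell] -/
def tri (u v w : Fin N → ℂ) : Pt N → ℂ := fun p => u p.1 * v p.2.1 * w p.2.2

/-- Additivity of `tri` in the first factor. [this cell] -/
theorem tri_add₁ (u u' v w : Fin N → ℂ) : tri (u + u') v w = tri u v w + tri u' v w := by
  funext p; simp only [tri, Pi.add_apply]; ring

/-- Additivity of `tri` in the second factor. [this cell] -/
theorem tri_add₂ (u v v' w : Fin N → ℂ) : tri u (v + v') w = tri u v w + tri u v' w := by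
  funext p; simp only [tri, Pi.add_apply]; ring

/-- Additivity of `tri` in the third factor. [this cell] -/
theorem tri_add₃ (u v w w' : Fin N → ℂ) : tri u v (w + w') = tri u v w + tri u v w' := by
  funext p; simp only [tri, Pi.add_apply]; ring

/-- The basis vector `e_x ∈ ℂ^N`. [this cell] -/
noncomputable def dlt (x : Fin N) : Fin N → ℂ := fun n => if n = x then 1 else 0

/-- A basis tensor is the triad of basis vectors. [this cell] -/
theorem basisTensor_eq_tri (x y z : Fin N) : basisTensor (x, y, z) = tri (dlt x) (dlt y) (dlt z) := by
  funext p
  obtain ⟨p1, p2, p3⟩ := p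
  simp only [basisTensor, tri, dlt, Prod.mk.injEq]
  by_cases h1 : p1 = x <;> by_cases h2 : p2 = y <;> by_cases h3 : p3 = z <;> simp [h1, h2, h3]

/-! ## The cube identity -/

/-- CUBE IDENTITY: for a bi-additive form vanishing on the diagonal of triads, the sum over the eight complementary
corner pairs of a `2 × 2 × 2` block vanishes. [this cell] -/
theorem cube_identity (β : (Pt N → ℂ) → (Pt N → ℂ) → ℂ)
    (hadd₁ : ∀ T₁ T₂ T', β (T₁ + T₂) T' = β T₁ T' + β T₂ T')
    (hadd₂ : ∀ T T₁' T₂', β T (T₁' + T₂') = β T T₁' + β T T₂')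
    (hdiag : ∀ u v w : Fin N → ℂ, β (tri u v w) (tri u v w) = 0)
    (u₀ u₁ v₀ v₁ w₀ w₁ : Fin N → ℂ) :
    β (tri u₀ v₀ w₀) (tri u₁ v₁ w₁) + β (tri u₁ v₀ w₀) (tri u₀ v₁ w₁)
      + β (tri u₀ v₁ w₀) (tri u₁ v₀ w₁) + β (tri u₀ v₀ w₁) (tri u₁ v₁ w₀)
      + β (tri u₁ v₁ w₀) (tri u₀ v₀ w₁) + β (tri u₁ v₀ w₁) (tri u₀ v₁ w₀)
      + β (tri u₀ v₁ w₁) (tri u₁ v₀ w₀) + β (tri u₁ v₁ w₁) (tri u₀ v₀ w₀) = 0 := by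
  have e000 := hdiag u₀ v₀ w₀
  have e001 := hdiag u₀ v₀ w₁
  have e002 := hdiag u₀ v₀ (w₀ + w₁)
  have e010 := hdiag u₀ v₁ w₀
  have e011 := hdiag u₀ v₁ w₁
  have e012 := hdiag u₀ v₁ (w₀ + w₁)
  have e020 := hdiag u₀ (v₀ + v₁) w₀
  have e021 := hdiag u₀ (v₀ + v₁) w₁
  have e022 := hdiag u₀ (v₀ + v₁) (w₀ + w₁)
  have e100 := hdiag u₁ v₀ w₀
  have e101 := hdiag u₁ v₀ w₁
  have e102 := hdiag u₁ v₀ (w₀ + w₁)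
  have e110 := hdiag u₁ v₁ w₀
  have e111 := hdiag u₁ v₁ w₁
  have e112 := hdiag u₁ v₁ (w₀ + w₁)
  have e120 := hdiag u₁ (v₀ + v₁) w₀
  have e121 := hdiag u₁ (v₀ + v₁) w₁
  have e122 := hdiag u₁ (v₀ + v₁) (w₀ + w₁)
  have e200 := hdiag (u₀ + u₁) v₀ w₀
  have e201 := hdiag (u₀ + u₁) v₀ w₁
  have e202 := hdiag (u₀ + u₁) v₀ (w₀ + w₁)
  have e210 := hdiag (u₀ + u₁) v₁ w₀
  have e211 := hdiag (u₀ + u₁) v₁ w₁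
  have e212 := hdiag (u₀ + u₁) v₁ (w₀ + w₁)
  have e220 := hdiag (u₀ + u₁) (v₀ + v₁) w₀
  have e221 := hdiag (u₀ + u₁) (v₀ + v₁) w₁
  have e222 := hdiag (u₀ + u₁) (v₀ + v₁) (w₀ + w₁)
  simp only [tri_add₁, tri_add₂, tri_add₃, hadd₁, hadd₂] at e000 e001 e002 e010 e011 e012 e020 e021 e022 e100 e101 e102 e110 e111 e112 e120 e121 e122 e200 e201 e202 e210 e211 e212 e220 e221 e222
  linear_combination - e000 - e001 + e002 - e010 - e011 + e012 + e020 + e021 - e022 - e100 - e101 + e102 - e110 - e111 + e112 + e120 + e121 - e122 + e200 + e201 - e202 + e210 + e211 - e212 - e220 - e221 + e222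

/-! ## The pair form -/

/-- The polar form as a function of the tensors in two slots `i`, `j`. [this cell] -/
noncomputable def pairForm (f : MvPolynomial (Pt N) ℂ) (y : Fin d → Pt N → ℂ) (i j : Fin d)
    (T T' : Pt N → ℂ) : ℂ :=
  polarForm f (Function.update (Function.update y i T) j T')

/-- Additivity in the slot-`i` tensor. [this cell] -/
theorem pairForm_add_left (f : MvPolynomial (Pt N) ℂ) (y : Fin d → Pt N → ℂ) {i j : Fin d} (hij : i ≠ j)
    (T₁ T₂ T' : Pt N → ℂ) :
    pairForm f y i j (T₁ + T₂) T' = pairForm f y i j T₁ T' + pairForm f y i j T₂ T' := by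
  simp only [pairForm, Function.update_comm hij]
  have h := (polarMultilinear f d).map_update_add (Function.update y j T') i T₁ T₂
  simpa only [polarMultilinear_apply] using h

/-- Additivity in the slot-`j` tensor. [this cell] -/
theorem pairForm_add_right (f : MvPolynomial (Pt N) ℂ) (y : Fin d → Pt N → ℂ) (i j : Fin d)
    (T T₁' T₂' : Pt N → ℂ) :
    pairForm f y i j T (T₁' + T₂') = pairForm f y i j T T₁' + pairForm f y i j T T₂' := by
  have h := (polarMultilinear f d).map_update_add (Function.update y i T) j T₁' T₂'
  simpa only [pairForm, polarMultilinear_apply] using h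

/-- Diagonal vanishing of the pair form at triads (DOUBLING VANISHING). [this cell; LM04 Lemma 3.1 polarised] -/
theorem pairForm_diag (f : MvPolynomial (Pt N) ℂ)
    (hf : ∀ t : Fin N → Fin N → Fin N → ℂ, tensorRank t < d →
      MvPolynomial.aeval (fun p : Pt N => t p.1 p.2.1 p.2.2) f = 0)
    (y : Fin d → Pt N → ℂ) (hy : ∀ k, ∃ u v w : Fin N → ℂ, ∀ p : Pt N, y k p = u p.1 * v p.2.1 * w p.2.2)
    {i j : Fin d} (hij : i ≠ j) (u v w : Fin N → ℂ) :
    pairForm f y i j (tri u v w) (tri u v w) = 0 := by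
  unfold pairForm
  refine polarForm_eq_zero_of_doubled f hf _ (fun k => ?_) hij ?_
  · rcases eq_or_ne k j with rfl | hkj
    · exact ⟨u, v, w, fun p => by simp [tri]⟩
    rcases eq_or_ne k i with rfl | hki
    · exact ⟨u, v, w, fun p => by simp [Function.update_of_ne hkj, tri]⟩
    · obtain ⟨u', v', w', h⟩ := hy k
      exact ⟨u', v', w', fun p => by simp [Function.update_of_ne hkj, Function.update_of_ne hki, h p]⟩
  · simp [Function.update_of_ne hij]

/-! ## The eight-term relation for `G3` -/

/-- A word triple agreeing with `(α, β, γ)` off `{i, j}` evaluates `G3` as the pair form at two basis triads.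
[this cell] -/
theorem G3_eq_pairForm (f : MvPolynomial (Pt N) ℂ) (α β γ : Fin d → Fin N) {i j : Fin d} (hij : i ≠ j)
    (α' β' γ' : Fin d → Fin N) (hα : ∀ k, k ≠ i → k ≠ j → α' k = α k)
    (hβ : ∀ k, k ≠ i → k ≠ j → β' k = β k) (hγ : ∀ k, k ≠ i → k ≠ j → γ' k = γ k) :
    G3 f α' β' γ' = pairForm f (fun k => basisTensor (α k, β k, γ k)) i j
      (basisTensor (α' i, β' i, γ' i)) (basisTensor (α' j, β' j, γ' j)) := by
  unfold G3 pairForm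
  congr 1
  funext k
  rcases eq_or_ne k j with rfl | hkj
  · simp
  rcases eq_or_ne k i with rfl | hki
  · simp [Function.update_of_ne hkj]
  · simp [Function.update_of_ne hkj, Function.update_of_ne hki, hα k hki hkj, hβ k hki hkj, hγ k hki hkj]

/-- Diagonal `S_d`-symmetry of `G3` under a transposition. [this cell] -/
theorem G3_symm (f : MvPolynomial (Pt N) ℂ) (i j : Fin d) (α β γ : Fin d → Fin N) :
    G3 f (α ∘ ⇑(Equiv.swap i j)) (β ∘ ⇑(Equiv.swap i j)) (γ ∘ ⇑(Equiv.swap i j)) = G3 f α β γ :=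
  G3_perm f α β γ (Equiv.swap i j)

/-- THE EIGHT-TERM RELATION for the coefficient tensor of a polynomial vanishing on rank `< d`: the cube identity for
the pair form at basis triads. [this cell; LM04 Lemma 3.1, Raicu2012 Prop. 3.4] -/
theorem G3_eight (f : MvPolynomial (Pt N) ℂ)
    (hf : ∀ t : Fin N → Fin N → Fin N → ℂ, tensorRank t < d →
      MvPolynomial.aeval (fun p : Pt N => t p.1 p.2.1 p.2.2) f = 0)
    {i j : Fin d} (hij : i ≠ j) (α β γ : Fin d → Fin N) :
    G3 f α β γ + G3 f (α ∘ ⇑(Equiv.swap i j)) β γ + G3 f α (β ∘ ⇑(Equiv.swap i j)) γ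
        + G3 f α β (γ ∘ ⇑(Equiv.swap i j))
        + G3 f (α ∘ ⇑(Equiv.swap i j)) (β ∘ ⇑(Equiv.swap i j)) γ
        + G3 f (α ∘ ⇑(Equiv.swap i j)) β (γ ∘ ⇑(Equiv.swap i j))
        + G3 f α (β ∘ ⇑(Equiv.swap i j)) (γ ∘ ⇑(Equiv.swap i j))
        + G3 f (α ∘ ⇑(Equiv.swap i j)) (β ∘ ⇑(Equiv.swap i j)) (γ ∘ ⇑(Equiv.swap i j)) = 0 := by
  have hsw : ∀ (δ : Fin d → Fin N) (k : Fin d), k ≠ i → k ≠ j → (δ ∘ ⇑(Equiv.swap i j)) k = δ k :=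
    fun δ k hki hkj => by
      show δ (Equiv.swap i j k) = δ k
      rw [Equiv.swap_apply_of_ne_of_ne hki hkj]
  have hid : ∀ (δ : Fin d → Fin N) (k : Fin d), k ≠ i → k ≠ j → δ k = δ k := fun _ _ _ _ => rfl
  have t000 : G3 f α β γ
      = pairForm f (fun k => basisTensor (α k, β k, γ k)) i j (tri (dlt (α i)) (dlt (β i)) (dlt (γ i))) (tri (dlt (α j)) (dlt (β j)) (dlt (γ j))) := by
    rw [G3_eq_pairForm f α β γ hij _ _ _ (hid α) (hid β) (hid γ)]
    simp only [basisTensor_eq_tri]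
  have t100 : G3 f (α ∘ ⇑(Equiv.swap i j)) β γ
      = pairForm f (fun k => basisTensor (α k, β k, γ k)) i j (tri (dlt (α j)) (dlt (β i)) (dlt (γ i))) (tri (dlt (α i)) (dlt (β j)) (dlt (γ j))) := by
    rw [G3_eq_pairForm f α β γ hij _ _ _ (hsw α) (hid β) (hid γ)]
    simp only [Function.comp_apply, Equiv.swap_apply_left, Equiv.swap_apply_right, basisTensor_eq_tri]
  have t010 : G3 f α (β ∘ ⇑(Equiv.swap i j)) γ
      = pairForm f (fun k => basisTensor (α k, β k, γ k)) i j (tri (dlt (α i)) (dlt (β j)) (dlt (γ i))) (tri (dlt (α j)) (dlt (β i)) (dlt (γ j))) := by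
    rw [G3_eq_pairForm f α β γ hij _ _ _ (hid α) (hsw β) (hid γ)]
    simp only [Function.comp_apply, Equiv.swap_apply_left, Equiv.swap_apply_right, basisTensor_eq_tri]
  have t001 : G3 f α β (γ ∘ ⇑(Equiv.swap i j))
      = pairForm f (fun k => basisTensor (α k, β k, γ k)) i j (tri (dlt (α i)) (dlt (β i)) (dlt (γ j))) (tri (dlt (α j)) (dlt (β j)) (dlt (γ i))) := by
    rw [G3_eq_pairForm f α β γ hij _ _ _ (hid α) (hid β) (hsw γ)]
    simp only [Function.comp_apply, Equiv.swap_apply_left, Equiv.swap_apply_right, basisTensor_eq_tri]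
  have t110 : G3 f (α ∘ ⇑(Equiv.swap i j)) (β ∘ ⇑(Equiv.swap i j)) γ
      = pairForm f (fun k => basisTensor (α k, β k, γ k)) i j (tri (dlt (α j)) (dlt (β j)) (dlt (γ i))) (tri (dlt (α i)) (dlt (β i)) (dlt (γ j))) := by
    rw [G3_eq_pairForm f α β γ hij _ _ _ (hsw α) (hsw β) (hid γ)]
    simp only [Function.comp_apply, Equiv.swap_apply_left, Equiv.swap_apply_right, basisTensor_eq_tri]
  have t101 : G3 f (α ∘ ⇑(Equiv.swap i j)) β (γ ∘ ⇑(Equiv.swap i j))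
      = pairForm f (fun k => basisTensor (α k, β k, γ k)) i j (tri (dlt (α j)) (dlt (β i)) (dlt (γ j))) (tri (dlt (α i)) (dlt (β j)) (dlt (γ i))) := by
    rw [G3_eq_pairForm f α β γ hij _ _ _ (hsw α) (hid β) (hsw γ)]
    simp only [Function.comp_apply, Equiv.swap_apply_left, Equiv.swap_apply_right, basisTensor_eq_tri]
  have t011 : G3 f α (β ∘ ⇑(Equiv.swap i j)) (γ ∘ ⇑(Equiv.swap i j))
      = pairForm f (fun k => basisTensor (α k, β k, γ k)) i j (tri (dlt (α i)) (dlt (β j)) (dlt (γ j))) (tri (dlt (α j)) (dlt (β i)) (dlt (γ i))) := by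
    rw [G3_eq_pairForm f α β γ hij _ _ _ (hid α) (hsw β) (hsw γ)]
    simp only [Function.comp_apply, Equiv.swap_apply_left, Equiv.swap_apply_right, basisTensor_eq_tri]
  have t111 : G3 f (α ∘ ⇑(Equiv.swap i j)) (β ∘ ⇑(Equiv.swap i j)) (γ ∘ ⇑(Equiv.swap i j))
      = pairForm f (fun k => basisTensor (α k, β k, γ k)) i j (tri (dlt (α j)) (dlt (β j)) (dlt (γ j))) (tri (dlt (α i)) (dlt (β i)) (dlt (γ i))) := by
    rw [G3_eq_pairForm f α β γ hij _ _ _ (hsw α) (hsw β) (hsw γ)]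
    simp only [Function.comp_apply, Equiv.swap_apply_left, Equiv.swap_apply_right, basisTensor_eq_tri]
  rw [t000, t100, t010, t001, t110, t101, t011, t111]
  exact cube_identity (pairForm f (fun k => basisTensor (α k, β k, γ k)) i j) (pairForm_add_left f _ hij)
    (pairForm_add_right f _ i j) (pairForm_diag f hf _ (fun k => basisTensor_triad (α k, β k, γ k)) hij)
    (dlt (α i)) (dlt (α j)) (dlt (β i)) (dlt (β j)) (dlt (γ i)) (dlt (γ j))

/-- THE PAIR-EXCHANGE RELATION for the coefficient tensor of a polynomial vanishing on rank `< d`. [this cell;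
LM04 Lemma 3.1, Raicu2012 Prop. 3.4] -/
theorem G3_pair (f : MvPolynomial (Pt N) ℂ)
    (hf : ∀ t : Fin N → Fin N → Fin N → ℂ, tensorRank t < d →
      MvPolynomial.aeval (fun p : Pt N => t p.1 p.2.1 p.2.2) f = 0)
    {i j : Fin d} (hij : i ≠ j) (α β γ : Fin d → Fin N) :
    G3 f α β γ + G3 f (α ∘ ⇑(Equiv.swap i j)) β γ + G3 f α (β ∘ ⇑(Equiv.swap i j)) γ
      + G3 f α β (γ ∘ ⇑(Equiv.swap i j)) = 0 :=
  pairExchange_of_polar (G3 (d := d) f) (G3_symm f) α β γ (G3_eight f hf hij α β γ)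

/-- `G3 f = 0` beyond the Casimir threshold. [this cell; NODE-g23 Theorem B] -/
theorem G3_eq_zero (hN : 2 ≤ N) (hd : 3 * N ≤ d + 2) (f : MvPolynomial (Pt N) ℂ)
    (hf : ∀ t : Fin N → Fin N → Fin N → ℂ, tensorRank t < d →
      MvPolynomial.aeval (fun p : Pt N => t p.1 p.2.1 p.2.2) f = 0) :
    G3 (d := d) f = 0 :=
  pairExchange_eq_zero hN hd (G3 (d := d) f) (fun _ _ hij α β γ => G3_pair f hf hij α β γ)

/-- THEOREM B (NODE-g23): `GapOneEquationsVanish` — for `N ≥ 2`, `d ≥ 3N − 2`, a homogeneous polynomial of degree `d`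
on `ℂ^N ⊗ ℂ^N ⊗ ℂ^N` vanishing on all tensors of rank `< d` is zero, i.e. `I_d(σ_{d−1}) = 0`. Decides item 27778.
[this cell; cite: LandsbergManivel2004, Lemma 3.1, Cor. 3.4; LandsbergGCT2017, Prop. 8.3.4.1] -/
theorem gapOneEquationsVanish_holds :
    Summit.MatrixMultiplication.MatrixMultiplication.Theses.ObstructionDescent.GapOneEquationsVanish := by
  intro N d hN hd f hf hvan
  refine eq_zero_of_G3_eq_zero f hf fun α β γ => ?_
  have h := G3_eq_zero hN hd f hvan
  exact congrFun (congrFun (congrFun h α) β) γ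

end Summit.MatrixMultiplication.MatrixMultiplication.Theorems.ObstructionDescentGapOne
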